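import Summits.QuantumAdvantage.QuantumAdvantage.Theses.StickelbergerGrid
import Literature.Computability.QuantumComplexity.CWrapAssembly
import Literature.Computability.Cryptography.ShorAssemblyLeavesProofs
import Literature.Computability.Complexity.BrickAlgebra
import HarnessLib

/-!
# Line `birth` — BC3 skeleton for the crux `GaussPowerFBQP` (stmt-QuantumAdvantage-17348)

Route `StickelbergerGrid` (route-QuantumAdvantage-StickelbergerGrid; deciding theorem
`closes (hX : SectorHardness) (hG : GaussPowerFBQP) (hP : SectorMembershipOfGrid) : QuantumAdvantage`),
crux #2 (rank 2, XL) — THE GRID: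

  `GaussPowerFBQP := ∀ C, ∃ f ∈ FBQP, ∀ valid (p, ℓ, r) with ℓ ≤ (log₂ p)^C, f ⟨p, ⟨ℓ, r⟩⟩ = code of the
   coefficient vector a ∈ ℤ^(ℓ−1) with Σ_{j<ℓ−1} a_j ζ_ℓ^j = S(p,ℓ,r)^ℓ`,

where `S(p,ℓ,r) = Σ_{1≤x<p} χ_r(x) e(x/p)` is the Gauss sum of the order-`ℓ` character pinned by `r`
(`χ_r(x) = ζ_ℓ^j iff r^j ≡ x^((p−1)/ℓ) (mod p)`), typed as the route's double indicator sum.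

## The line (the route's re-audited on-paper proof, cut along the arithmetic / algorithmic / closure seams)

The re-audit of the crux (route-repair seat + crux-attack refuter, item notes 2026-08-17) records that the
grid is CLASSICAL on paper: `S^ℓ = χ(−1) p ∏_{i=1}^{ℓ−2} J(χ,χ^i)` (IrelandRosen1990 Prop. 8.3.3, `χ(−1) = 1`
for odd `ℓ`), each Jacobi sum `J(χ,χ^i) ∈ ℤ[ζ_ℓ]` generates an ideal with EXPLICIT prime factorisation
(Stickelberger, IrelandRosen1990 Ch. 14 Thm 2 / Washington1997 §6.2) and satisfies `J·J̄ = p`, which is exactly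
the input of the Gentry–Szydlo / Lenstra–Silverberg lattice algorithm (GentrySzydlo2002 §7; LenstraSilverberg2014
Thm 1.1) recovering `J` up to `μ_{2ℓ}` in deterministic time poly(ℓ, log p); the root of unity is pinned by the
congruence `J ≡ −1 (mod (1 − ζ_ℓ)²)`.  Hence `FP`, hence `FBQP` (`FP ⊆ FBQP`, proved below from the tree's
classical-wrap theorem).  Write `J_i(p,ℓ,r) := Σ_{2≤x<p} χ_r(x) χ_r(1−x)^i` (typed as a triple indicator sum;
`1 − x ≡ p + 1 − x`).

* `stub_gaussJacobi` (ARITHMETIC, size M–L; IrelandRosen1990 Prop. 8.3.3 + the dictionary typed sum ↔ Mathlib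
  `gaussSum`/`jacobiSum`, Mathlib `gaussSum_pow_eq_prod_jacobiSum`): for valid `(p, ℓ, r)` (no size bound),
  `S^ℓ = p · ∏_{i ∈ [1, ℓ−2]} J_i`.  Why it might fail: not mathematically (checked numerically to 1e−14 for
  eleven `(p, ℓ)` up to `(53, 13)`); the dictionary (order-ℓ `MulChar` on `ZMod p` from `r`, `χ(−1) = 1`) is the work.
* `stub_jacobiFP` (ALGORITHMIC NUMBER THEORY in `FP`, size XL — the load-bearing stub): for every `C` one `FP`
  function which, on valid `(p, ℓ, r, i)` with `ℓ ≤ (log₂ p)^C`, `1 ≤ i ≤ ℓ−2`, outputs the code of the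
  coefficient vector `b ∈ ℤ^(ℓ−1)` of `J_i = Σ_{j<ℓ−1} b_j ζ_ℓ^j` (unique: `1, ζ, …, ζ^(ℓ−2)` is a ℤ-basis of
  `ℤ[ζ_ℓ]`).  On paper: Stickelberger exponents of `(J_i)` over the `ℓ−1` primes above `p` → ℤ-basis (HNF) of the
  ideal → Gentry–Szydlo/Lenstra–Silverberg with `J_i J̄_i = p` → `J_i` up to `μ_{2ℓ}` → congruence mod `(1−ζ)²`.
  Why it might fail: not on paper (deterministic, GRH-free); AS TYPED it needs the GS/LS lattice algorithm and
  prime ideals of `ℤ[ζ_ℓ]` in the tree's `FP` model (nothing of it exists yet).  (A quantum proof — Biasse–Song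
  S-units / PIP — would only give `FBQP`; then prove the `FBQP` weakening of this stub together with
  `stub_productFP`'s `FBQP` analogue — a reshape for the lead, not this line.)
* `stub_productFP` (CLOSURE in `FP`, size M–L): from such a single-Jacobi-sum routine, one `FP` function which on
  valid `(p, ℓ, r)` outputs the code of the coefficient vector of `p · ∏_{i=1}^{ℓ−2} J_i` — a counted loop of
  `ℓ − 2 ≤ (log₂ p)^C` calls (`Brick` combinators), exact decoding of each answer (`listBool.decode_encode`),
  multiplication in `ℤ[X]/(Φ_ℓ)` on `(ℓ−1)`-vectors with entries `≤ p^{ℓ/2}·2^ℓ` (poly bits), scaling by `p`.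
  Why it might fail: not mathematically; `FP` bookkeeping of the loop and of cyclotomic reduction is new.
* Composition `GaussPowerFBQP_of` (sorry-free, kernel-checked): `f := ` the product routine; `f ∈ FBQP` by
  `mem_FBQP_of_mem_FP` (proved here: `isQSolvable_classicalWrap_holds` with pre-processor `id`, post-processor
  `g ∘ fstF`, around the tree's Shor family as the trivial quantum core, then `IsQSolvable.mono`); on a valid
  input the product routine's vector `a` has `Σ a_j ζ^j = p ∏ J_i = S^ℓ` by `stub_gaussJacobi`.

Disproof used: none exists for this crux (`ledger crux ls stmt-QuantumAdvantage-17348`: no workfiles before this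
line, no `Disproof.lean`, no `Theorems/…/Negative`); `ledger negatives --problem QuantumAdvantage` has no Gauss-sum
statement.  `sorry` occurs ONLY in the three `stub_*` theorems; `GaussPowerFBQP_of` takes the three stub statements
(the `Goal.stub_*` abbreviations, restated verbatim by the stubs) and concludes the crux decl BY NAME; the `example`
at the end checks that the registered stubs feed it.
-/

set_option linter.dupNamespace false
set_option linter.unusedVariables false

namespace Summit.QuantumAdvantage.QuantumAdvantage.Cruxes.GaussPowerFBQP.Birth

open scoped BigOperators Classical
open _root_.Computability Literature.Computability.Complexity Literature.Computability.Cryptography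
open Summit.QuantumAdvantage.QuantumAdvantage.Theses.StickelbergerGrid (GaussPowerFBQP)

/-! ### The three stub statements (named, so that the composition can take them as hypotheses) -/

namespace Goal

/-- Statement of `stub_gaussJacobi`: `S(p,ℓ,r)^ℓ = p · ∏_{i=1}^{ℓ−2} J_i(p,ℓ,r)` for valid `(p, ℓ, r)`
(IrelandRosen1990 Prop. 8.3.3 with `χ(−1) = 1`). -/
abbrev stub_gaussJacobi : Prop :=
  ∀ p ℓ r : ℕ, p.Prime ∧ ℓ.Prime ∧ Odd ℓ ∧ ℓ ∣ p - 1 ∧ r < p ∧ r ^ ℓ % p = 1 ∧ r % p ≠ 1 → (∑ x ∈ Finset.Icc 1 (p - 1), ∑ j ∈ Finset.range ℓ, if r ^ j % p = x ^ ((p - 1) / ℓ) % p then Complex.exp (2 * Real.pi * Complex.I * ((j : ℂ) / (ℓ : ℂ) + (x : ℂ) / (p : ℂ))) else 0) ^ ℓ = (p : ℂ) * ∏ i ∈ Finset.Icc 1 (ℓ - 2), (∑ x ∈ Finset.Icc 2 (p - 1), ∑ j ∈ Finset.range ℓ, ∑ k ∈ Finset.range ℓ, if r ^ j % p = x ^ ((p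 - 1) / ℓ) % p ∧ r ^ k % p = (p + 1 - x) ^ ((p - 1) / ℓ) % p then Complex.exp (2 * Real.pi * Complex.I * ((j : ℂ) + (i : ℂ) * (k : ℂ)) / (ℓ : ℂ)) else 0)

/-- Statement of `stub_jacobiFP`: the coefficient vector of one Jacobi sum `J_i(p,ℓ,r) ∈ ℤ[ζ_ℓ]` is an `FP`
function of `(p, ℓ, r, i)` in the range `ℓ ≤ (log₂ p)^C` (Stickelberger + Gentry–Szydlo/Lenstra–Silverberg). -/
abbrev stub_jacobiFP : Prop :=
  ∀ C : ℕ, ∃ g : List Bool → List Bool, g ∈ Literature.Computability.Complexity.FP ∧ ∀ p ℓ r i : ℕ, p.Prime ∧ ℓ.Prime ∧ Odd ℓ ∧ ℓ ∣ p - 1 ∧ ℓ ≤ Nat.log 2 p ^ C ∧ r < p ∧ r ^ ℓ % p = 1 ∧ r % p ≠ 1 ∧ 1 ≤ i ∧ i ≤ ℓ - 2 → ∃ b : List ℤ, b.length = ℓ - 1 ∧ (∑ j ∈ Finset.range (ℓ - 1), ((b.getD j 0 : ℤ) : ℂ) * Complex.exp (2 * Real.pi * Complex.I * (j : ℂ)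 / (ℓ : ℂ))) = (∑ x ∈ Finset.Icc 2 (p - 1), ∑ j ∈ Finset.range ℓ, ∑ k ∈ Finset.range ℓ, if r ^ j % p = x ^ ((p - 1) / ℓ) % p ∧ r ^ k % p = (p + 1 - x) ^ ((p - 1) / ℓ) % p then Complex.exp (2 * Real.pi * Complex.I * ((j : ℂ) + (i : ℂ) * (k : ℂ)) / (ℓ : ℂ)) else 0) ∧ g ((Computability.encodingNatBool.pairBool (Computability.encodingNatBool.pairBool (Computability.encodingNatBool.pairBool Computability.encodingNatBool))).encode (p, (ℓ, (r, i)))) = (Literature.Computability.Complexity.encodingIntBool.listBool).encode b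

/-- Statement of `stub_productFP`: from the single-Jacobi-sum routine, the coefficient vector of
`p · ∏_{i=1}^{ℓ−2} J_i(p,ℓ,r)` is an `FP` function of `(p, ℓ, r)` (counted loop + arithmetic in `ℤ[X]/(Φ_ℓ)`). -/
abbrev stub_productFP : Prop :=
  (∀ C : ℕ, ∃ g : List Bool → List Bool, g ∈ Literature.Computability.Complexity.FP ∧ ∀ p ℓ r i : ℕ, p.Prime ∧ ℓ.Prime ∧ Odd ℓ ∧ ℓ ∣ p - 1 ∧ ℓ ≤ Nat.log 2 p ^ C ∧ r < p ∧ r ^ ℓ % p = 1 ∧ r % p ≠ 1 ∧ 1 ≤ i ∧ i ≤ ℓ - 2 → ∃ b : List ℤ, b.length = ℓ - 1 ∧ (∑ j ∈ Finset.range (ℓ - 1), ((b.getD j 0 : ℤ) : ℂ) * Complex.exp (2 * Real.pi * Complex.I * (j : ℂ) / (ℓ : ℂ))) = (∑ x ∈ Finset.Icc 2 (p - 1), ∑ j ∈ Finset.range ℓ, ∑ k ∈ Finset.range ℓ, if r ^ j % p = x ^ ((p - 1) / ℓ) % p ∧ r ^ k % p = (p + 1 - x) ^ ((p - 1) / ℓ)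 % p then Complex.exp (2 * Real.pi * Complex.I * ((j : ℂ) + (i : ℂ) * (k : ℂ)) / (ℓ : ℂ)) else 0) ∧ g ((Computability.encodingNatBool.pairBool (Computability.encodingNatBool.pairBool (Computability.encodingNatBool.pairBool Computability.encodingNatBool))).encode (p, (ℓ, (r, i)))) = (Literature.Computability.Complexity.encodingIntBool.listBool).encode b) → ∀ C : ℕ, ∃ f : List Bool → List Bool, f ∈ Literature.Computability.Complexity.FP ∧ ∀ p ℓ r : ℕ, p.Prime ∧ ℓ.Prime ∧ Odd ℓ ∧ ℓ ∣ p - 1 ∧ ℓ ≤ Nat.log 2 p ^ C ∧ r < p ∧ r ^ ℓ % p = 1 ∧ r % p ≠ 1 → ∃ a : List ℤ, a.length = ℓ - 1 ∧ (∑ j ∈ Finset.range (ℓ - 1), ((a.getD j 0 : ℤ) : ℂ) * Complex.exp (2 * Real.pi * Complex.I * (j : ℂ) / (ℓ : ℂ))) = (p : ℂ) * ∏ i ∈ Finset.Icc 1 (ℓ - 2), (∑ x ∈ Finset.Icc 2 (p - 1), ∑ j ∈ Finset.range ℓ, ∑ k ∈ Finset.range ℓ, if r ^ j % p = x ^ ((p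 - 1) / ℓ) % p ∧ r ^ k % p = (p + 1 - x) ^ ((p - 1) / ℓ) % p then Complex.exp (2 * Real.pi * Complex.I * ((j : ℂ) + (i : ℂ) * (k : ℂ)) / (ℓ : ℂ)) else 0) ∧ f ((Computability.encodingNatBool.pairBool (Computability.encodingNatBool.pairBool Computability.encodingNatBool)).encode (p, (ℓ, r))) = (Literature.Computability.Complexity.encodingIntBool.listBool).encode a

end Goal

/-! ### The stubs (registered; `sorry` lives only here) -/

/-- **stub_gaussJacobi** (arithmetic; IrelandRosen1990 Prop. 8.3.3, Mathlib `gaussSum_pow_eq_prod_jacobiSum`,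
dictionary typed indicator sums ↔ `gaussSum χ_r ψ₁` / `jacobiSum χ_r χ_r^i`; M–L). -/
theorem stub_gaussJacobi : ∀ p ℓ r : ℕ, p.Prime ∧ ℓ.Prime ∧ Odd ℓ ∧ ℓ ∣ p - 1 ∧ r < p ∧ r ^ ℓ % p = 1 ∧ r % p ≠ 1 → (∑ x ∈ Finset.Icc 1 (p - 1), ∑ j ∈ Finset.range ℓ, if r ^ j % p = x ^ ((p - 1) / ℓ) % p then Complex.exp (2 * Real.pi * Complex.I * ((j : ℂ) / (ℓ : ℂ) + (x : ℂ) / (p : ℂ))) else 0) ^ ℓ = (p : ℂ) * ∏ i ∈ Finset.Icc 1 (ℓ - 2), (∑ x ∈ Finset.Icc 2 (p - 1), ∑ j ∈ Finset.range ℓ, ∑ k ∈ Finset.range ℓ, if r ^ j % p = x ^ ((p - 1) / ℓ) % p ∧ r ^ k % p = (p + 1 - x) ^ ((p - 1) / ℓ) % p then Complex.exp (2 * Real.pi * Complex.I * ((j : ℂ) + (i : ℂ) * (k : ℂ)) / (ℓ : ℂ)) else 0) := by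
  sorry

/-- **stub_jacobiFP** (algorithmic number theory in `FP`; Stickelberger factorisation of `(J(χ,χ^i))`
(IrelandRosen1990 Ch. 14 Thm 2, Washington1997 §6.2) + Gentry–Szydlo / LenstraSilverberg2014 Thm 1.1 with
`J J̄ = p` + the congruence `J ≡ −1 mod (1−ζ_ℓ)²`; XL, load-bearing). -/
theorem stub_jacobiFP : ∀ C : ℕ, ∃ g : List Bool → List Bool, g ∈ Literature.Computability.Complexity.FP ∧ ∀ p ℓ r i : ℕ, p.Prime ∧ ℓ.Prime ∧ Odd ℓ ∧ ℓ ∣ p - 1 ∧ ℓ ≤ Nat.log 2 p ^ C ∧ r < p ∧ r ^ ℓ % p = 1 ∧ r % p ≠ 1 ∧ 1 ≤ i ∧ i ≤ ℓ - 2 → ∃ b : List ℤ, b.length = ℓ - 1 ∧ (∑ j ∈ Finset.range (ℓ - 1), ((b.getD j 0 : ℤ) : ℂ) * Complex.exp (2 * Real.pi * Complex.I * (j : ℂ) / (ℓ : ℂ))) = (∑ x ∈ Finset.Icc 2 (p - 1), ∑ j ∈ Finset.range ℓ, ∑ k ∈ Finset.range ℓ, if r ^ j % p = x ^ ((p - 1)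 / ℓ) % p ∧ r ^ k % p = (p + 1 - x) ^ ((p - 1) / ℓ) % p then Complex.exp (2 * Real.pi * Complex.I * ((j : ℂ) + (i : ℂ) * (k : ℂ)) / (ℓ : ℂ)) else 0) ∧ g ((Computability.encodingNatBool.pairBool (Computability.encodingNatBool.pairBool (Computability.encodingNatBool.pairBool Computability.encodingNatBool))).encode (p, (ℓ, (r, i)))) = (Literature.Computability.Complexity.encodingIntBool.listBool).encode b := by
  sorry

/-- **stub_productFP** (closure: counted loop of `ℓ−2` calls + exact product in `ℤ[X]/(Φ_ℓ)` + scaling by `p`,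
all in `FP`; M–L). -/
theorem stub_productFP : (∀ C : ℕ, ∃ g : List Bool → List Bool, g ∈ Literature.Computability.Complexity.FP ∧ ∀ p ℓ r i : ℕ, p.Prime ∧ ℓ.Prime ∧ Odd ℓ ∧ ℓ ∣ p - 1 ∧ ℓ ≤ Nat.log 2 p ^ C ∧ r < p ∧ r ^ ℓ % p = 1 ∧ r % p ≠ 1 ∧ 1 ≤ i ∧ i ≤ ℓ - 2 → ∃ b : List ℤ, b.length = ℓ - 1 ∧ (∑ j ∈ Finset.range (ℓ - 1), ((b.getD j 0 : ℤ) : ℂ) * Complex.exp (2 * Real.pi * Complex.I * (j : ℂ) / (ℓ : ℂ))) = (∑ x ∈ Finset.Icc 2 (p - 1), ∑ j ∈ Finset.range ℓ, ∑ k ∈ Finset.range ℓ, if r ^ j % p = x ^ ((p - 1) / ℓ) % p ∧ r ^ k % p = (p + 1 - x) ^ ((p - 1) / ℓ) % p then Complex.exp (2 * Real.pi * Complex.I * ((j : ℂ) + (i : ℂ) * (k : ℂ)) / (ℓ : ℂ)) else 0) ∧ g ((Computability.encodingNatBool.pairBool (Computability.encodingNatBool.pairBool (Computability.encodingNatBool.pairBool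 Computability.encodingNatBool))).encode (p, (ℓ, (r, i)))) = (Literature.Computability.Complexity.encodingIntBool.listBool).encode b) → ∀ C : ℕ, ∃ f : List Bool → List Bool, f ∈ Literature.Computability.Complexity.FP ∧ ∀ p ℓ r : ℕ, p.Prime ∧ ℓ.Prime ∧ Odd ℓ ∧ ℓ ∣ p - 1 ∧ ℓ ≤ Nat.log 2 p ^ C ∧ r < p ∧ r ^ ℓ % p = 1 ∧ r % p ≠ 1 → ∃ a : List ℤ, a.length = ℓ - 1 ∧ (∑ j ∈ Finset.range (ℓ - 1), ((a.getD j 0 : ℤ) : ℂ) * Complex.exp (2 * Real.pi * Complex.I * (j : ℂ) / (ℓ : ℂ))) = (p : ℂ) * ∏ i ∈ Finset.Icc 1 (ℓ - 2), (∑ x ∈ Finset.Icc 2 (p - 1), ∑ j ∈ Finset.range ℓ, ∑ k ∈ Finset.range ℓ, if r ^ j % p = x ^ ((p - 1) / ℓ) % p ∧ r ^ k % p = (p + 1 - x) ^ ((p - 1) / ℓ) % p then Complex.exp (2 * Real.pi * Complex.I * ((j : ℂ) + (i : ℂ) * (k : ℂ)) / (ℓ : ℂ)) else 0) ∧ f ((Computability.encodingNatBool.pairBool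 (Computability.encodingNatBool.pairBool Computability.encodingNatBool)).encode (p, (ℓ, r))) = (Literature.Computability.Complexity.encodingIntBool.listBool).encode a := by
  sorry

/-! ### `FP ⊆ FBQP` (Bernstein–Vazirani 1997 §8), proved from the tree's classical-wrap theorem -/

/-- **`FP ⊆ FBQP`**: a deterministic polynomial-time string function is computable in bounded-error quantum
polynomial time.  Proof over the tree's model: wrap ANY solvable quantum search core (here Shor's factoring family,
`isQSolvable_factoring_holds`) with pre-processor `id` and post-processor `g ∘ fstF` (`isQSolvable_classicalWrap_holds`):
the wrapped family writes `g ⟨x, y⟩.1 = g x` first, whatever `y` is; then `IsQSolvable.mono`. -/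
theorem mem_FBQP_of_mem_FP {g : List Bool → List Bool} (hg : g ∈ FP) : g ∈ FBQP := by
  have hW := isQSolvable_classicalWrap_holds id (g ∘ Brick.fstF) (PolyTimeComputable.id _)
    (comp_mem_FP hg Brick.fstF_mem_FP) isQSolvable_factoring_holds
  show IsQSolvable fun x => {y | g x <+: y}
  refine hW.mono fun x z hz => ?_
  obtain ⟨y, -, hyz⟩ := hz
  simpa [Function.comp, Brick.fstF_boolPair] using hyz

/-! ### The composition (sorry-free) -/

/-- **Composition of the birth line** (kernel-checked, no `sorry`): the three stub statements give the crux
`Theses.StickelbergerGrid.GaussPowerFBQP` BY NAME — the product routine is the witness, it is in `FBQP` because it is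
in `FP`, and its output is `S^ℓ` by the Gauss–Jacobi identity. -/
theorem GaussPowerFBQP_of (h₁ : Goal.stub_gaussJacobi) (h₂ : Goal.stub_jacobiFP) (h₃ : Goal.stub_productFP) :
    GaussPowerFBQP := by
  unfold GaussPowerFBQP
  intro C
  obtain ⟨f, hfFP, hf⟩ := h₃ h₂ C
  refine ⟨f, mem_FBQP_of_mem_FP hfFP, ?_⟩
  rintro p ℓ r ⟨hp, hℓ, hodd, hdvd, hC, hr, hrℓ, hr1⟩
  obtain ⟨a, hlen, ha, hfa⟩ := hf p ℓ r ⟨hp, hℓ, hodd, hdvd, hC, hr, hrℓ, hr1⟩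
  exact ⟨a, hlen, ha.trans (h₁ p ℓ r ⟨hp, hℓ, hodd, hdvd, hr, hrℓ, hr1⟩).symm, hfa⟩

/-- The registered stubs feed the composition (checks that the inline stub statements are the `Goal.*` ones). -/
example : GaussPowerFBQP := GaussPowerFBQP_of stub_gaussJacobi stub_jacobiFP stub_productFP

end Summit.QuantumAdvantage.QuantumAdvantage.Cruxes.GaussPowerFBQP.Birth
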